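import Literature.NumberTheory.EllipticCurves.CongruenceNumber
import Literature.NumberTheory.EllipticCurves.PastenValuationProductThm75Proofs
import Mathlib.Analysis.SpecialFunctions.Pow.Real
import HarnessLib

/-!
# Height, modular degree, congruence number, discriminant and conductor of elliptic curves over `ℚ`
# via modularity (von Känel 2014, §6; von Känel–Matschke 2016/2023, §10.5)

Topic `Literature/NumberTheory/EllipticCurves` (family `abc`, LADDER-ABC A1: the *modular method*). The
elliptic-curve half of the literature-typing of

* R. von Känel, B. Matschke, *Solving `S`-unit, Mordell, Thue, Thue–Mahler and generalized
  Ramanujan–Nagell equations via Shimura–Taniyama conjecture*, arXiv:1605.06079 (Feb. 2016 version, held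
  TeX text) = Mem. AMS **286** (2023) no. 1419 [`VonkanelMatschke2023`], **§10.5** "Optimized height
  bounds and height conductor inequalities" (arXiv numbering: (10.x) `def:bb*` for `β, β*, α`,
  Prop. 10.8 = `prop:explbounds` (i)–(iii), display (10.x) `eq:szpiro` and its asymptotic form, Remark
  10.10);
* R. von Känel, *Integral points on moduli schemes of elliptic curves*, Trans. LMS **1** (2014) =
  arXiv:1310.7263 [`VonKanelModuli2014`], **§6.1**: Prop. 6.1 (`prop:he`), Cor. 6.2 (`cor:de`), Cor. 6.3
  (`cor:shaf`), Prop. 6.4 (`prop:shaf`).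

The Diophantine half (`S`-unit, `abc`, Mordell bounds) is
`Literature/NumberTheory/DiophantineGeometry/SUnitMordellHeightBoundsModularity.lean`.

## Dictionary (tree vocabulary, as in `PastenHeightBounds.lean` / `CongruenceNumber.lean`)

* `E/ℚ` of conductor `N = N_E`: `W : WeierstrassCurve ℚ`, `[W.IsElliptic]`, `N = W.conductorNorm ℤ`;
  minimal discriminant `Δ_E = W.minimalDiscriminantNorm ℤ` (a natural number).
* `h(E)` = the relative Faltings height with Faltings' normalisation (vKM §10.2 "defined … using Faltings'
  original normalization of the metric"; vK §2.1: `‖α‖² = (i/2)∫ α ∧ ᾱ`), i.e. `−½ log covol(Λ_Néron)`: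
  `neronLatticeHeight L` for a period pair `L` spanning the Néron lattice of a GLOBALLY MINIMAL model
  (`[W.IsGloballyMinimal]`, `IsNeronLatticeOf (W.baseChange ℂ) L`; a modular parametrisation datum `D`
  carries such an `L` as `D.L`).
* "`f` the newform associated to `E`", `m_f` its modular degree (degree of `X₀(N) → E_f`, `E_f` the
  optimal quotient), `r_f` its congruence number ((2.x) `def:mf`, `def:rf`): a datum
  `D : ModularParametrizationData W N` of `W` itself fixes `f = D.f`; `m_f = D'.modularDegree` for a datum
  `D'` (of some `W'`) with `D'.f = D.f` and degree MINIMAL among all data with that newform (the phrasing of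
  `modularDegree_dvd_congruenceNumber`, i.e. `W'` optimal); `r_f = congruenceNumber D.f` (definition (ii) of
  Agashe–Ribet–Stein, printed equivalent to vKM's (def:rf) = their (i)).
* `ν = N ν*(N)`, `ν*(p) = 1`, `ν*(p^k) = 1 − 1/p²` (`k ≥ 2`) (Prop. 10.8 (ii)): `condNu N`.
* `β, β*, α = min(β, β*)` ((10.x) `def:bb*`): `vkmBeta`, `vkmBetaStar`, `vkmAlpha`, built from
  `m` = number of newforms of level dividing `N` (`newformCount`: `Σ_{M ∣ N} dim S₂^{new}(Γ₀(M))`, newforms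
  being a basis of the new subspace), `g = genusX0 N`, `l = ⌊(N/6)∏_{p∣N}(p+1)⌋`,
  `l* = ⌊(N/6)∏_{p∣N}(1+1/p)⌋ = ⌊gamma0Index N / 6⌋`, `τ` = number of divisors, and
  `max_J Σ_{j∈J} log(τ(j) j^{1/2})` over `J ⊆ {1,…,l}` of cardinality `m` (`maxLogTauSum`, taken over
  `|J| ≤ m`, which is the same maximum because every summand `log(τ(j)√j)` is `≥ 0`).
* `κ = 4π + log(163/π)` (Prop. 10.8 (i)): `vkmKappa`.
* `log log log` is `Real.log ∘ Real.log ∘ Real.log` (real; conductors are `≥ 11 > e^e^0`).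

## What is here / NOT here

Here (named facts `def … : Prop`, D-0014, nothing discharged): vKM Prop. 10.8 (i), (ii), (iii), the
discriminant–conductor inequality (10.x) `eq:szpiro` with its asymptotic form; vK 2014 Prop. 6.1,
Cor. 6.2, Cor. 6.3, Prop. 6.4. PROVED: `condNu_nonneg`, `condNu_le_self` ("`ν ≤ N`" of Prop. 10.8 (ii)),
`exists_minimal_datum_of_newform` (a minimal-degree datum with a given newform exists), and the combined explicit
Faltings-height bound `two_mul_height_le_of_prop_10_8` (`2h(E) ≤ κ + (1/6)ν log N + (1/16)ν log₃ N + (1/9)ν`)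
from (i)+(ii); and vK Cor. 6.2 in minimal-model form from Prop. 6.1 + the tree's PROVED
`pasten2024_log_minimalDiscriminant_le_holds` (`vonKanel2014_log_abs_Δ_le_of`), mirroring the printed proof.
NOT here: Prop. 10.7 (`prop:algobounds`, the optimized `S`-unit/Mordell bounds `(6/5)α(2^𝔢N_S) + 28` etc.
— needs the sibling file's vocabulary); the bars `β̄, β̄*, ᾱ` ((10.x) `eq:barbb`); Remark 10.9 (Pasten's
results — in the tree as `pasten2024_height_lt`); vKM Lemma 10.5 / vK Prop. 3.2, 3.4 (Frey–Hellegouarch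
and Mordell Paršin constructions; cf. the tree's `conductorNorm_freyCurve_dvd`); vK Thm. 7.1 (moduli
schemes `M(𝒫)` — no moduli-problem vocabulary in the tree); vK §§8–9 (`GL₂`-type, Theorems B, C). The
divisibility `m_f ∣ r_f` is the tree's `modularDegree_dvd_congruenceNumber` (Agashe–Ribet–Stein) and the
inequality `log Δ_E ≤ 12 h(E) + 16` (vK Lemma 3.3) is the tree's `pasten2024_log_minimalDiscriminant_le`;
neither is restated. No `abc` claim; typed ≠ proved.
-/

noncomputable section

open WeierstrassCurve IsDedekindDomain

namespace Literature.NumberTheory.EllipticCurves.ModularForms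

/-! ### The quantities `ν`, `κ`, `m`, `l`, `l*`, `β`, `β*`, `α` -/

/-- `ν = ν(N) = N · ν*(N)` with `ν*` multiplicative, `ν*(p) = 1`, `ν*(p^k) = 1 − 1/p²` for `k ≥ 2`
(vKM Prop. 10.8 (ii)); i.e. `ν = N ∏_{p² ∣ N} (1 − p⁻²)`. [cite: VonkanelMatschke2023, Prop. 10.8 (ii) (arXiv §10.5.2)] -/
def condNu (N : ℕ) : ℝ :=
  (N : ℝ) * ∏ p ∈ N.primeFactors.filter (fun p => p ^ 2 ∣ N), (1 - 1 / (p : ℝ) ^ 2)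

/-- `κ = 4π + log(163/π)` (vKM Prop. 10.8 (i); `163` from Mazur–Kenku's bound on `ℚ`-isogenies).
[cite: VonkanelMatschke2023, Prop. 10.8 (i) (arXiv §10.5.2)] -/
def vkmKappa : ℝ := 4 * Real.pi + Real.log (163 / Real.pi)

/-- `m = m(N)`, the number of newforms (of weight `2` for `Γ₀`) of level dividing `N` ((10.x) `def:bb*`),
rendered as `Σ_{M ∣ N} dim_ℂ S₂^{new}(Γ₀(M))` (the newforms of level `M` are a basis of the new subspace
`newSubspace0 M 2`, Atkin–Lehner). [cite: VonkanelMatschke2023, §10.5.1 (def:bb*)] -/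
def newformCount (N : ℕ) : ℕ :=
  ∑ M : N.divisors,
    (haveI : NeZero (M : ℕ) := ⟨(Nat.pos_of_mem_divisors M.2).ne'⟩
     Module.finrank ℂ (newSubspace0 (M : ℕ) 2))

/-- `l = ⌊(N/6) ∏_{p ∣ N} (p + 1)⌋` ((10.x) `def:bb*`). [cite: VonkanelMatschke2023, §10.5.1 (def:bb*)] -/
def vkmIndexL (N : ℕ) : ℕ := N * (∏ p ∈ N.primeFactors, (p + 1)) / 6

/-- `l* = ⌊(N/6) ∏_{p ∣ N} (1 + 1/p)⌋ = ⌊[SL₂(ℤ) : Γ₀(N)] / 6⌋` ((10.x) `def:bb*`; `gamma0Index N =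
N ∏_{p∣N}(1 + 1/p)`). [cite: VonkanelMatschke2023, §10.5.1 (def:bb*)] -/
def vkmIndexLStar (N : ℕ) : ℕ := gamma0Index N / 6

/-- `max_J Σ_{j ∈ J} log(τ(j) · j^{1/2})`, the maximum over subsets `J ⊆ {1, …, l}` of cardinality `m`
((10.x) `def:bb*`; `τ` = number of divisors). Taken here over `|J| ≤ m` so that the index set is never
empty; since every summand `log(τ(j)√j)` (`j ≥ 1`) is `≥ 0`, this is the printed maximum whenever
`m ≤ l`, and the full sum otherwise. [cite: VonkanelMatschke2023, §10.5.1 (def:bb*)] -/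
def maxLogTauSum (l m : ℕ) : ℝ :=
  (((Finset.Icc 1 l).powerset.filter fun J => J.card ≤ m).sup'
      ⟨∅, by simp⟩) fun J => ∑ j ∈ J, Real.log ((j.divisors.card : ℝ) * Real.sqrt j)

/-- `β = ½ m log m + max_J Σ_{j∈J} log(τ(j) j^{1/2})`, `J ⊆ {1,…,l}`, `|J| = m` ((10.x) `def:bb*`).
[cite: VonkanelMatschke2023, §10.5.1 (def:bb*)] -/
def vkmBeta (N : ℕ) : ℝ :=
  1 / 2 * (newformCount N : ℝ) * Real.log (newformCount N) + maxLogTauSum (vkmIndexL N) (newformCount N)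

/-- `β* = ½ g log g + max_J Σ_{j∈J} log(τ(j) j^{1/2})`, `J ⊆ {1,…,l*}`, `|J| = g`, `g = g(X₀(N))`
((10.x) `def:bb*`). [cite: VonkanelMatschke2023, §10.5.1 (def:bb*)] -/
def vkmBetaStar (N : ℕ) : ℝ :=
  1 / 2 * (genusX0 N : ℝ) * Real.log (genusX0 N) + maxLogTauSum (vkmIndexLStar N) (genusX0 N)

/-- `α = min(β, β*)` ((10.x) after `def:bb*`: "we shall work in our algorithms with the quantity
`α = min(β, β*)`"). [cite: VonkanelMatschke2023, §10.5.1 (def:bb*)] -/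
def vkmAlpha (N : ℕ) : ℝ := min (vkmBeta N) (vkmBetaStar N)

/-- `ν ≥ 0`. [cite: VonkanelMatschke2023, Prop. 10.8 (ii)] -/
theorem condNu_nonneg (N : ℕ) : 0 ≤ condNu N := by
  unfold condNu
  refine mul_nonneg (Nat.cast_nonneg N) (Finset.prod_nonneg fun p hp => ?_)
  have hp2 : (2 : ℝ) ≤ p := by exact_mod_cast (Nat.prime_of_mem_primeFactors (Finset.mem_filter.mp hp).1).two_le
  have : 1 / (p : ℝ) ^ 2 ≤ 1 := by
    rw [div_le_one (by positivity)]; nlinarith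
  linarith

/-- **`ν ≤ N`** (the last clause of vKM Prop. 10.8 (ii)), PROVED: each factor `1 − p⁻²` lies in `[0, 1]`.
[cite: VonkanelMatschke2023, Prop. 10.8 (ii)] -/
theorem condNu_le_self (N : ℕ) : condNu N ≤ N := by
  unfold condNu
  have h1 : ∏ p ∈ N.primeFactors.filter (fun p => p ^ 2 ∣ N), (1 - 1 / (p : ℝ) ^ 2) ≤ 1 := by
    refine Finset.prod_le_one (fun p hp => ?_) (fun p hp => ?_)
    · have hp2 : (2 : ℝ) ≤ p := by
        exact_mod_cast (Nat.prime_of_mem_primeFactors (Finset.mem_filter.mp hp).1).two_le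
      have : 1 / (p : ℝ) ^ 2 ≤ 1 := by
        rw [div_le_one (by positivity)]; nlinarith
      linarith
    · have : 0 ≤ 1 / (p : ℝ) ^ 2 := by positivity
      linarith
  calc (N : ℝ) * _ ≤ (N : ℝ) * 1 := mul_le_mul_of_nonneg_left h1 (Nat.cast_nonneg N)
    _ = N := mul_one _

/-! ### von Känel–Matschke, Prop. 10.8 (= `prop:explbounds`) -/

/-- **vKM Prop. 10.8 (i).** *"Suppose that `E` is an elliptic curve over `ℚ` of conductor `N`, with
associated newform `f`. (i) Define `κ = 4π + log(163/π)`. There are inequalities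
`2h(E) − κ ≤ log m_f ≤ log r_f ≤ α = min(β, β*)`."* Rendering (module docstring): `E` = a globally
minimal `W` with its own level-`N` datum `D` (so `f = D.f`, `h(E) = neronLatticeHeight D.L`), `m_f` = the
degree of a minimal-degree datum `D'` with newform `f` (optimal quotient), `r_f = congruenceNumber D.f`.
Proof in print (§10.5.3): Frey's approach via the modular degree as in [vK 2014] with the "coprime" matrix of
Murty–Pasten (Atkin–Lehner basis, Hadamard, `r_f² ∣ det(F)²`), `m_f ∣ r_f` [Agashe–Ribet–Stein], and
`h(E) ≤ ½ log m_f + 2π + ½ log(163/π)` from [vK 2014]. [cite: VonkanelMatschke2023, Prop. 10.8 (i) (arXiv §10.5.2, prop:explbounds)] -/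
def vonKanelMatschke_prop_10_8_i : Prop :=
  ∀ (W : WeierstrassCurve ℚ) [W.IsElliptic] [W.IsGloballyMinimal] (N : ℕ) [NeZero N],
    W.conductorNorm ℤ = N → ∀ (D : ModularParametrizationData W N)
    (W' : WeierstrassCurve ℚ) [W'.IsElliptic] (D' : ModularParametrizationData W' N), D'.f = D.f →
    (∀ (W'' : WeierstrassCurve ℚ) [W''.IsElliptic] (D'' : ModularParametrizationData W'' N),
        D''.f = D'.f → D'.modularDegree ≤ D''.modularDegree) →
      2 * neronLatticeHeight D.L - vkmKappa ≤ Real.log D'.modularDegree ∧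
      Real.log D'.modularDegree ≤ Real.log (congruenceNumber D.f) ∧
      Real.log (congruenceNumber D.f) ≤ vkmAlpha N

/-- **vKM Prop. 10.8 (ii).** *"It holds `β ≤ (1/6) ν log N + (1/16) ν log log log N + (1/9) ν`, `ν ≤ N`."*
Scope: `N` is the conductor of an elliptic curve over `ℚ` in Prop. 10.8; the printed proof (§10.5.3:
Martin's formula `m ≤ (ν+1)/12`, `l ≤ (e^γ/π²) N² (log log N + 2/log log N)`, `τ(n) ≤ 8.5 n^{1/4}`)
establishes the inequality "for all `N ≥ 23`" and checks "`11 ≤ N < 23`" by machine, so it is recorded for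
all `N ≥ 11`; the clause `ν ≤ N` is PROVED (`condNu_le_self`). [cite: VonkanelMatschke2023, Prop. 10.8 (ii) (arXiv §10.5.2)] -/
def vonKanelMatschke_prop_10_8_ii : Prop :=
  ∀ N : ℕ, 11 ≤ N →
    vkmBeta N ≤ 1 / 6 * condNu N * Real.log N + 1 / 16 * condNu N * Real.log (Real.log (Real.log N)) +
      1 / 9 * condNu N

/-- **vKM Prop. 10.8 (iii).** *"If `N → ∞` then `β ≤ (1/8) ν log N + ((1/6) log 2 + o(1))/(log log N) · ν log N`."*
Rendered: for every `δ > 0` there is `N₀` with `β ≤ (1/8) ν log N + (((1/6) log 2 + δ)/log log N) ν log N`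
for all `N ≥ N₀` (Wigert's bound replaces `τ(n) ≤ 8.5 n^{1/4}`). [cite: VonkanelMatschke2023, Prop. 10.8 (iii) (arXiv §10.5.2)] -/
def vonKanelMatschke_prop_10_8_iii : Prop :=
  ∀ δ : ℝ, 0 < δ → ∃ N₀ : ℕ, ∀ N : ℕ, N₀ ≤ N →
    vkmBeta N ≤ 1 / 8 * condNu N * Real.log N +
      (1 / 6 * Real.log 2 + δ) / Real.log (Real.log N) * (condNu N * Real.log N)

/-- **vKM (10.x) `eq:szpiro` — explicit discriminant–conductor inequality** (Remark 10.10ff: "Proposition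
10.8 together with [vK 2014] directly implies that any elliptic curve `E` over `ℚ` of conductor `N` and
minimal discriminant `Δ_E` satisfies `log Δ_E ≤ ν log N + (3/8) ν log log log N + (2/3) ν + 115.1` … These
inequalities update the discriminant conductor inequalities in Murty–Pasten and in [vK 2014]"), `ν` as in
Prop. 10.8 (ii). An explicit, exponential discriminant–conductor inequality valid for every `E/ℚ` (a
THEOREM in print; no polynomial bound `|Δ| ≪ N^{6+ε}` is asserted here).
[cite: VonkanelMatschke2023, §10.5.3 display (eq:szpiro)] -/
def vonKanelMatschke_log_minimalDiscriminant_le : Prop :=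
  ∀ (W : WeierstrassCurve ℚ) [W.IsElliptic],
    Real.log (W.minimalDiscriminantNorm ℤ) ≤
      condNu (W.conductorNorm ℤ) * Real.log (W.conductorNorm ℤ) +
        3 / 8 * condNu (W.conductorNorm ℤ) * Real.log (Real.log (Real.log (W.conductorNorm ℤ))) +
        2 / 3 * condNu (W.conductorNorm ℤ) + 115.1

/-- **vKM, asymptotic form of `eq:szpiro`**: *"if `N → ∞` then
`log Δ_E ≤ (3/4) ν log N + ((log 2 + o(1))/log log N) ν log N`"*. Rendered with `δ > 0` and a threshold `N₀`
on the conductor. [cite: VonkanelMatschke2023, §10.5.3 display after (eq:szpiro)] -/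
def vonKanelMatschke_log_minimalDiscriminant_le_asymptotic : Prop :=
  ∀ δ : ℝ, 0 < δ → ∃ N₀ : ℕ, ∀ (W : WeierstrassCurve ℚ) [W.IsElliptic], N₀ ≤ W.conductorNorm ℤ →
    Real.log (W.minimalDiscriminantNorm ℤ) ≤
      3 / 4 * condNu (W.conductorNorm ℤ) * Real.log (W.conductorNorm ℤ) +
        (Real.log 2 + δ) / Real.log (Real.log (W.conductorNorm ℤ)) *
          (condNu (W.conductorNorm ℤ) * Real.log (W.conductorNorm ℤ))

/-! ### von Känel 2014, §6.1 -/

/-- **von Känel 2014, Prop. 6.1** (an exponential height–conductor bound for all elliptic curves over `ℚ`,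
a THEOREM in print): *"If `E` is an elliptic curve over `ℚ`, then `h(E) ≤ (1/4) N_E (log N_E)² + 9`."*
(`h(E)` the relative Faltings height, Faltings' normalisation = `neronLatticeHeight` of the Néron lattice
of a global minimal model.) Proof in print (§6.2): Shimura–Taniyama `X₀(N) → E`, Frey's strategy via an
optimal quotient (Lemma 4.1), bound for the modular degree (Lemma 5.1). Superseded by vKM Prop. 10.8
("updates `2h(E) ≤ ½ N (log N)² + 18`"). [cite: VonKanelModuli2014, Prop. 6.1] -/
def vonKanel2014_height_le : Prop :=
  ∀ (W : WeierstrassCurve ℚ) [W.IsElliptic] [W.IsGloballyMinimal] (L : PeriodPair),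
    IsNeronLatticeOf (W.baseChange ℂ) L →
      neronLatticeHeight L ≤
        1 / 4 * (W.conductorNorm ℤ : ℝ) * Real.log (W.conductorNorm ℤ) ^ 2 + 9

/-- **von Känel 2014, Cor. 6.2** (an explicit exponential discriminant–conductor inequality, a THEOREM in
print): *"Any elliptic curve `E` over `ℚ` satisfies `log Δ_E ≤ 3 N_E (log N_E)² + 124`"* (`Δ_E` the norm
of the minimal discriminant ideal). Printed proof: Prop. 6.1 and `log Δ_E ≤ 12 h(E) + 16` (Lemma 3.3) — see
`vonKanel2014_log_abs_Δ_le_of`. [cite: VonKanelModuli2014, Cor. 6.2] -/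
def vonKanel2014_log_minimalDiscriminant_le : Prop :=
  ∀ (W : WeierstrassCurve ℚ) [W.IsElliptic],
    Real.log (W.minimalDiscriminantNorm ℤ) ≤
      3 * (W.conductorNorm ℤ : ℝ) * Real.log (W.conductorNorm ℤ) ^ 2 + 124

/-- **The printed proof of Cor. 6.2, PROVED in the tree's minimal-model form**: Prop. 6.1 and the
inequality `log |Δ_min| ≤ 12 h(E) + 16` (vK Lemma 3.3 = the tree's `pasten2024_log_minimalDiscriminant_le`,
Silverman; PROVED in the tree, `pasten2024_log_minimalDiscriminant_le_holds`) give `log |Δ_W| ≤ 3 N (log N)² + 124` for every globally minimal `W` with a Néron period pair.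
[cite: VonKanelModuli2014, Cor. 6.2 (proof)] -/
theorem vonKanel2014_log_abs_Δ_le_of (h61 : vonKanel2014_height_le) (W : WeierstrassCurve ℚ)
    [W.IsElliptic] [W.IsGloballyMinimal] (L : PeriodPair) (hL : IsNeronLatticeOf (W.baseChange ℂ) L) :
    Real.log |((W.Δ : ℚ) : ℝ)| ≤ 3 * (W.conductorNorm ℤ : ℝ) * Real.log (W.conductorNorm ℤ) ^ 2 + 124 := by
  have h1 := h61 W L hL
  have h2 := pasten2024_log_minimalDiscriminant_le_holds W L hL
  linarith

/-- **von Känel 2014, Cor. 6.3** (a fully effective Shafarevich-type finiteness THEOREM for elliptic curves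
over `ℚ`): with `ν_S = 12³ N_S²`, `N_S` the product of the (finitely many) rational primes outside
the open `S ⊆ Spec ℤ` — here: of the primes in the finite set `S` of bad places allowed — *"If `[E]` is a
`ℚ`-isomorphism class of elliptic curves over `ℚ` with good reduction over `S` [= outside the finite set],
then there exists a Weierstrass model `W` of `E` over `Spec(ℤ)` that satisfies `h(W) ≤ ½ ν_S (log ν_S)²`"*,
where for `K = ℚ` ((3.x) `def:w`, `𝒪_K^× = {±1}`) `h(W) = (1/12) h(c₄³, c₆²) = (1/12) log max(1, |c₄|³, |c₆|²)`
(affine logarithmic Weil height of the integer vector). Rendered: an integral model `W₀` reached from `W` by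
an admissible change of variables over `ℚ`. [cite: VonKanelModuli2014, Cor. 6.3] -/
def vonKanel2014_exists_integralModel_height_le : Prop :=
  ∀ (S : Finset (HeightOneSpectrum ℤ)) (W : WeierstrassCurve ℚ) [W.IsElliptic],
    (∀ v : HeightOneSpectrum ℤ, v ∉ S → W.HasGoodReductionAt v) →
      ∃ W₀ : WeierstrassCurve ℤ, (∃ C : VariableChange ℚ, C • W = W₀.baseChange ℚ) ∧
        1 / 12 * Real.log ((max 1 (max (|W₀.c₄| ^ 3) (|W₀.c₆| ^ 2)) : ℤ) : ℝ) ≤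
          1 / 2 * (1728 * (∏ v ∈ S, Ideal.absNorm v.asIdeal) ^ 2 : ℕ) *
            Real.log (1728 * (∏ v ∈ S, Ideal.absNorm v.asIdeal) ^ 2 : ℕ) ^ 2

/-- **von Känel 2014, Prop. 6.4**: *"`N(S) ≤ (2/3) ν_S ∏_{p ∣ ν_S} (1 + 1/p)`"*, `N(S)` the number of
`ℚ`-isomorphism classes of elliptic curves over `ℚ` with good reduction outside the finite set `S`,
`ν_S = 12³ N_S²`. Rendered as in the tree's `WeierstrassCurve.shafarevich_finite_goodReductionOutside`: a
finite set `F` of models of that cardinality met by the `VariableChange ℚ`-orbit of every such curve.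
Proof in print: Shimura–Taniyama and Mazur–Kenku. [cite: VonKanelModuli2014, Prop. 6.4] -/
def vonKanel2014_card_goodReductionOutside_le : Prop :=
  ∀ (S : Finset (HeightOneSpectrum ℤ)), ∃ F : Finset (WeierstrassCurve ℚ),
    (F.card : ℝ) ≤ 2 / 3 * (1728 * (∏ v ∈ S, Ideal.absNorm v.asIdeal) ^ 2 : ℕ) *
        ∏ p ∈ (1728 * (∏ v ∈ S, Ideal.absNorm v.asIdeal) ^ 2).primeFactors, (1 + 1 / ((p : ℕ) : ℝ)) ∧
      ∀ (W : WeierstrassCurve ℚ) [W.IsElliptic],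
        (∀ v : HeightOneSpectrum ℤ, v ∉ S → W.HasGoodReductionAt v) → ∃ C : VariableChange ℚ, C • W ∈ F

/-! ### Proved consequences -/

/-- **Explicit Faltings-height bound from Prop. 10.8 (i)+(ii)** (PROVED from the two named facts): every
elliptic curve `E/ℚ` of conductor `N ≥ 11`, given by a globally minimal model with a modular parametrisation
datum at level `N`, satisfies `2 h(E) ≤ κ + (1/6) ν log N + (1/16) ν log log log N + (1/9) ν` — vKM's update
of Murty–Pasten's `2h(E) ≤ (1/5) N log N + 22` (remark after Prop. 10.8).
[cite: VonkanelMatschke2023, Prop. 10.8 (i)–(ii) and the remark following it] -/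
theorem two_mul_height_le_of_prop_10_8 (hi : vonKanelMatschke_prop_10_8_i)
    (hii : vonKanelMatschke_prop_10_8_ii) (W : WeierstrassCurve ℚ) [W.IsElliptic] [W.IsGloballyMinimal]
    (N : ℕ) [NeZero N] (hN : W.conductorNorm ℤ = N) (h11 : 11 ≤ N) (D : ModularParametrizationData W N) :
    2 * neronLatticeHeight D.L ≤ vkmKappa + (1 / 6 * condNu N * Real.log N +
      1 / 16 * condNu N * Real.log (Real.log (Real.log N)) + 1 / 9 * condNu N) := by
  obtain ⟨W', hW', D', hf, hmin⟩ := Pasten2024.exists_minimal_datum_in_class D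
  obtain ⟨h1, h2, h3⟩ := hi W N hN D W' D' hf hmin
  have h4 := hii N h11
  have h5 : vkmAlpha N ≤ vkmBeta N := min_le_left _ _
  linarith

end Literature.NumberTheory.EllipticCurves.ModularForms

end
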